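/-
Copyright: lit-balaban cell, Phase-2 proof seat p24 (gen 24).  Released under Apache 2.0 license as described in the
file LICENSE.
-/
import Literature.MathematicalPhysics.QuantumFieldTheory.Balaban1983to89.B4Ineq228FreePropagator

/-!
# `Balaban1983to89.B4Eq16FreePropagatorL2` — [Balaban1983RegularityDecay] (1.6) p. 572 ∕ (1.8) p. 573 ∕ (2.28) p. 580 for the FREE
# PROPAGATOR on `ξℤ^{d+1}`: `−Δ^ξ + m² + aQ_j^*Q_j` is a BIJECTION of `ℓ²(ξℤ^{d+1})` and `G_j = (−Δ^ξ + m² + aQ_j^*Q_j)⁻¹` is a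
# bounded operator on `ℓ²`, `‖G_j‖ ≤ (min{8,a} + m²)⁻¹`

statement-level skeleton of published theorems with citation tags; proofs where landed; nothing here is a claim about
the Yang–Mills mass gap

CITATION HEADER.  T. Bałaban, *Regularity and decay of lattice Green's functions*, Commun. Math. Phys. **89** (1983)
571–597, doi:10.1007/bf01214744 [Balaban1983RegularityDecay] (cell paper B4; held text
`paper:balaban1983-cmp89-regularity-decay`, journal page = PDF page + 570), p. 572 [PDF 2] (1.6), p. 573 [PDF 3] (1.8), p. 580
[PDF 10] (2.28), p. 584 [PDF 14] (2.44)–(2.46) (unit `lit-balaban-p24` gen 24; HOME `run/shared/lean/pub/lit-balaban/`; SKELETON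
rows **B4.Eq1.6**, **B4.Eq1.8**, **B4.Eq2.27**, **B4.Eq2.43** — cells only, all proved-headed; companion of
`B4Ineq227LatticeL2` ((1.8) on `ℓ²(ξℤ^{d+1})`), `B4Ineq228FreePropagator` ((2.28) for `G_j` on `ℓ¹` data) and
`B4Eq246SquareSummable` (`G_jf ∈ ℓ²`, «φ₀ = G_jf» two-sided)).

WHAT IS PRINTED.  p. 572: «Our fundamental Green's function is a kernel of the operator G_k(Ω, A) = (−Δ^{η,N}_{A,Ω} + m² +
aP_k(A))⁻¹ (1.6) where m² ≥ 0 and a is a positive constant close to 1. We consider all these operators under the assumption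
that the vector field A is regular on Ω in the sense that … (1.7)»; p. 573: «The operator defining the Green's function (1.6)
has a strictly positive lower bound … (1.8) … This bound justifies the definition (1.6)»; p. 580: «0 < G_k(□,0) ≤ c₀I …
‖G_k(□,0)f‖₂ ≤ c₀‖f‖₂ (2.28)»; p. 584: «the propagator G_j with free boundary conditions on ξZ^d … (−Δ^ξ + m_j² + a_jQ_j^*Q_j)φ₀ = f
(2.44) Defining the propagator G_j, φ₀ = G_jf» (the Hilbert-space reading is printed for the unit-lattice operators of Sect. 5,
p. 593 [PDF 23]: «The operators are considered as defined on L²(Ω^{(k)}).»).  OUR GLOSS (not a quotation): for the infinite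
`Ω = ξℤ^{d+1}` the definition (1.6) as an inverse on the square-summable functions asks for an inverse on ALL of `ℓ²`; the tree
had the inverse on `ℓ¹` data (`G246`, via (2.46)) and the lower bound (1.8) on `ℓ²` (`B4Ineq227LatticeL2`), i.e. injectivity
with a quantitative modulus; this file supplies SURJECTIVITY on `ℓ²` by `ℓ²`-approximation with finitely supported data.

WHAT THIS MODULE PROVES (kernel-checked; theorems only — no definition, no `Prop` fact, 0 `sorry`; axioms standard).
`n ≥ 1`, `a ≥ 0`, `m² > 0`, `γ₀ = min{8,a} + m²`, `D = B4Green244.opD n a m²`, lattice `ξℤ^{d+1}`: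
* `G246_sub` — `G_j` is additive on `ℓ¹` data: `G_j(f − g) = G_jf − G_jg` (by the `ℓ²` uniqueness of `B4Eq246SquareSummable`);
* **`exists_l2_solution`** — for EVERY `f ∈ ℓ²(ξℤ^{d+1})` there is `ψ ∈ ℓ²` with `Dψ = f`: the truncations `f_N = f·1_{[−N,N]^{d+1}}`
  are `ℓ¹`, `G_jf_N` is `ℓ²`-Cauchy by (2.28) (`B4Ineq228FreePropagator.G246_l2_bound'`) since `f_N → f` in `ℓ²`, `ℓ²` is
  complete (Mathlib's `lp`, `p = 2`), and `D` passes to pointwise limits (finite stencil);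
* **`existsUnique_l2_solution_of_l2`** — with `B4Eq244L2Unique.opD_injective_l2`: `D` is a BIJECTION of `ℓ²(ξℤ^{d+1})`, i.e.
  `G_j = D⁻¹` exists on all of `ℓ²` for `Ω = ξℤ^{d+1}`, `A = 0`; **`l2_solution_bound`** — every `ℓ²` solution obeys
  `γ₀‖ψ‖_{ℓ²} ≤ ‖f‖_{ℓ²}` («G_j ≤ c₀I», (2.28)); `l2_solution_eq_G246` — on `ℓ¹` data the `ℓ²` solution is `G246 f`.
* §4 **`exists_l2_solution_massless`** (`m² = 0 < a`): surjectivity on `ℓ²` by the second limit `m² ↓ 0` of the massive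
  solutions (uniform bound `‖ψ_{m²}‖ ≤ ‖f‖/min{8,a}`, `ℓ²`-Cauchy by (1.8) at `m² = 0`); **`existsUnique_l2_solution_of_pos`** —
  (1.6) for `Ω = ξℤ^{d+1}`, `A = 0` in print's FULL range «m² ≥ 0 and a … positive» (precisely: whenever `min{8,a} + m² > 0`).

DICTIONARY / HONEST SCOPE.  (i) `A = 0`, scalar fields, `Ω = ξℤ^{d+1}`; §§2–3 use `m² > 0` (the (2.46) route behind `G246`),
§4 reaches `m² = 0 < a` by a limit — no closed formula of type (2.46) for the massless propagator is given; constants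
`c₀⁻¹ = min{π²,a_k} ↦ min{8,a} + m²` (repaired, census G-B4-03).  (ii) No operator object
`G_j : ℓ² → ℓ²` is DEFINED (theorems only: existence, uniqueness, bound); `Classical.choose` of `exists_l2_solution` would be it.
(iii) Value = kernel certificate that the free propagator of p. 584 is an everywhere-defined bounded inverse on `ℓ²(ξℤ^{d+1})`
(our gloss of (1.6) + (1.8)), for all «m² ≥ 0 and a … positive»; cells only; NOT summit progress.
-/

namespace Literature.MathematicalPhysics.QuantumFieldTheory.Balaban1983to89.B4Eq16FreePropagatorL2

open Complex Finset Filter Topology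
open Literature.MathematicalPhysics.QuantumFieldTheory.Balaban1983to89.B4Green244
open Literature.MathematicalPhysics.QuantumFieldTheory.Balaban1983to89.B4Eq244L2Unique
open Literature.MathematicalPhysics.QuantumFieldTheory.Balaban1983to89.B4Eq246SolvesEq244
open Literature.MathematicalPhysics.QuantumFieldTheory.Balaban1983to89.B4Eq246SquareSummable
open Literature.MathematicalPhysics.QuantumFieldTheory.Balaban1983to89.B4Ineq227LatticeL2
open Literature.MathematicalPhysics.QuantumFieldTheory.Balaban1983to89.B4Ineq228FreePropagator
open scoped Real ComplexConjugate ENNReal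

noncomputable section

variable {d : ℕ}

/-! ### §1 `ℓ²(ξℤ^{d+1})` bookkeeping: completeness (Mathlib's `lp`, `p = 2`), the finite stencil, truncations -/

/-- `(2 : ℝ≥0∞).toReal = 2 > 0`. [folklore] -/
private theorem two_toReal_pos : 0 < (2 : ℝ≥0∞).toReal := by norm_num

/-- an `ℓ²` field is an element of `lp (fun _ => ℂ) 2`. [folklore] -/
private theorem memℓp_two {φ : (Fin (d + 1) → ℤ) → ℂ} (hφ : Summable fun z => ‖φ z‖ ^ 2) :
    Memℓp φ 2 := by
  rw [memℓp_gen_iff two_toReal_pos]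
  refine hφ.congr fun z => ?_
  rw [ENNReal.toReal_ofNat, Real.rpow_two]

/-- an element of `lp (fun _ => ℂ) 2` is an `ℓ²` field. [folklore] -/
private theorem summable_of_memℓp_two {φ : (Fin (d + 1) → ℤ) → ℂ} (hφ : Memℓp φ 2) :
    Summable fun z => ‖φ z‖ ^ 2 := by
  have h := (memℓp_gen_iff two_toReal_pos).mp hφ
  refine h.congr fun z => ?_
  rw [ENNReal.toReal_ofNat, Real.rpow_two]

/-- the `lp` norm at `p = 2` is the square root of the sum of squares. [folklore] -/
private theorem lp_norm_eq_sqrt (F : lp (fun _ : Fin (d + 1) → ℤ => ℂ) 2) :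
    ‖F‖ = Real.sqrt (∑' z, ‖F z‖ ^ 2) := by
  rw [lp.norm_eq_tsum_rpow two_toReal_pos F, Real.sqrt_eq_rpow, ENNReal.toReal_ofNat]
  congr 1
  exact tsum_congr fun z => Real.rpow_two _

/-- the `lp` distance of two `ℓ²` fields. [folklore] -/
private theorem lp_norm_sub_eq_sqrt (F G : lp (fun _ : Fin (d + 1) → ℤ => ℂ) 2) :
    ‖F - G‖ = Real.sqrt (∑' z, ‖F z - G z‖ ^ 2) := by
  rw [lp_norm_eq_sqrt]
  rfl

/-- **completeness of `ℓ²(ξℤ^{d+1})`** in the language of square-summable fields: an `ℓ²`-Cauchy sequence of square-summable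
fields converges, in `ℓ²` and pointwise, to a square-summable field. [folklore] -/
private theorem exists_limit_of_cauchy {ψ : ℕ → (Fin (d + 1) → ℤ) → ℂ} (hψ : ∀ N, Summable fun z => ‖ψ N z‖ ^ 2)
    (hC : ∀ ε > 0, ∃ N₀, ∀ N ≥ N₀, ∀ M ≥ N₀, Real.sqrt (∑' z, ‖ψ N z - ψ M z‖ ^ 2) < ε) :
    ∃ φ : (Fin (d + 1) → ℤ) → ℂ, (Summable fun z => ‖φ z‖ ^ 2)
      ∧ (∀ z, Tendsto (fun N => ψ N z) atTop (𝓝 (φ z)))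
      ∧ Tendsto (fun N => Real.sqrt (∑' z, ‖ψ N z - φ z‖ ^ 2)) atTop (𝓝 0) := by
  set F : ℕ → lp (fun _ : Fin (d + 1) → ℤ => ℂ) 2 := fun N => ⟨ψ N, memℓp_two (hψ N)⟩ with hF
  have hFapp : ∀ N z, F N z = ψ N z := fun N z => rfl
  have hcau : CauchySeq F := by
    refine Metric.cauchySeq_iff.mpr fun ε hε => ?_
    obtain ⟨N₀, hN₀⟩ := hC ε hε
    refine ⟨N₀, fun N hN M hM => ?_⟩
    rw [dist_eq_norm, lp_norm_sub_eq_sqrt]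
    simpa only [hFapp] using hN₀ N hN M hM
  obtain ⟨G, hG⟩ := cauchySeq_tendsto_of_complete hcau
  refine ⟨⇑G, summable_of_memℓp_two G.2, fun z => ?_, ?_⟩
  · have hcoe : Tendsto (fun N => (⇑(F N) : (Fin (d + 1) → ℤ) → ℂ)) atTop (𝓝 ⇑G) :=
      ((lp.uniformContinuous_coe (p := (2 : ℝ≥0∞))).continuous.tendsto G).comp hG
    exact ((continuous_apply z).continuousAt.tendsto.comp hcoe).congr fun N => rfl
  · have h1 : Tendsto (fun N => ‖F N - G‖) atTop (𝓝 0) := tendsto_iff_norm_sub_tendsto_zero.mp hG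
    refine h1.congr fun N => ?_
    rw [lp_norm_sub_eq_sqrt]

/-- the operator of (2.44) is continuous under pointwise convergence (finite stencil). [folklore] -/
private theorem tendsto_opD {ψ : ℕ → (Fin (d + 1) → ℤ) → ℂ} {φ : (Fin (d + 1) → ℤ) → ℂ}
    (h : ∀ z, Tendsto (fun N => ψ N z) atTop (𝓝 (φ z))) (n : ℕ) (a m2 : ℝ) (z : Fin (d + 1) → ℤ) :
    Tendsto (fun N => opD n a m2 (ψ N) z) atTop (𝓝 (opD n a m2 φ z)) := by
  simp_rw [opD_eq_stencil]
  exact tendsto_finsetSum _ fun i _ => (h _).const_mul _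

/-- the centred cubes `[−N, N]^{d+1}` of the fine lattice. [folklore] -/
private theorem mem_cube_of_le {N : ℕ} {z : Fin (d + 1) → ℤ} (hz : ∀ i, |z i| ≤ N) :
    z ∈ Fintype.piFinset fun _ : Fin (d + 1) => Finset.Icc (-(N : ℤ)) N := by
  rw [Fintype.mem_piFinset]
  intro i
  rw [Finset.mem_Icc]
  exact abs_le.mp (hz i)

/-- the cubes exhaust the lattice. [folklore] -/
private theorem tendsto_cube_atTop :
    Tendsto (fun N : ℕ => Fintype.piFinset fun _ : Fin (d + 1) => Finset.Icc (-(N : ℤ)) N) atTop atTop := by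
  refine tendsto_atTop_finset_of_monotone (fun N M hNM => ?_) fun z => ?_
  · intro z hz
    rw [Fintype.mem_piFinset] at hz ⊢
    intro i
    have := hz i
    rw [Finset.mem_Icc] at this ⊢
    constructor <;> [linarith [this.1, (Nat.cast_le (α := ℤ)).mpr hNM]; linarith [this.2, (Nat.cast_le (α := ℤ)).mpr hNM]]
  · obtain ⟨N, hN⟩ : ∃ N : ℕ, ∀ i, |z i| ≤ N := by
      refine ⟨(Finset.univ.sup fun i => (z i).natAbs), fun i => ?_⟩
      have h1 : (z i).natAbs ≤ Finset.univ.sup fun i => (z i).natAbs :=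
        Finset.le_sup (f := fun i => (z i).natAbs) (Finset.mem_univ i)
      rw [← Int.natCast_natAbs]
      exact_mod_cast h1
    exact ⟨N, mem_cube_of_le hN⟩

/-- **the truncations of an `ℓ²` field converge to it in `ℓ²`**: `Σ_{z∉[−N,N]^{d+1}}|f(z)|² → 0`, written for the truncated
field `f·1_{[−N,N]^{d+1}}`. [folklore] -/
private theorem tendsto_truncation (f : (Fin (d + 1) → ℤ) → ℂ) :
    Tendsto (fun N : ℕ => ∑' z, ‖f z -
        (if z ∈ Fintype.piFinset (fun _ : Fin (d + 1) => Finset.Icc (-(N : ℤ)) N) then f z else 0)‖ ^ 2)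
      atTop (𝓝 0) := by
  have h0 := (tendsto_tsum_compl_atTop_zero (fun z => ‖f z‖ ^ 2)).comp (tendsto_cube_atTop (d := d))
  refine h0.congr fun N => ?_
  simp only [Function.comp]
  set s := Fintype.piFinset (fun _ : Fin (d + 1) => Finset.Icc (-(N : ℤ)) N) with hs
  rw [← tsum_subtype_eq_of_support_subset (s := ((↑s : Set (Fin (d + 1) → ℤ))ᶜ))]
  · exact tsum_congr fun z => by
      have hz : (z : Fin (d + 1) → ℤ) ∉ s := z.2
      simp [hz]
  · intro z hz
    rw [Function.mem_support] at hz
    simp only [Set.mem_compl_iff, Finset.mem_coe]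
    intro hzs
    apply hz
    simp [hzs]

/-! ### §2 `G_j` is additive on `ℓ¹` data -/

/-- `ℓ¹` is closed under differences. [folklore] -/
private theorem summable_norm_sub {f g : (Fin (d + 1) → ℤ) → ℂ} (hf : Summable fun z => ‖f z‖)
    (hg : Summable fun z => ‖g z‖) : Summable fun z => ‖f z - g z‖ :=
  Summable.of_nonneg_of_le (fun _ => norm_nonneg _) (fun _ => norm_sub_le _ _) (hf.add hg)

/-- `ℓ²` is closed under differences. [folklore] -/
private theorem summable_normSq_sub {f g : (Fin (d + 1) → ℤ) → ℂ} (hf : Summable fun z => ‖f z‖ ^ 2)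
    (hg : Summable fun z => ‖g z‖ ^ 2) : Summable fun z => ‖f z - g z‖ ^ 2 := by
  refine Summable.of_nonneg_of_le (fun z => sq_nonneg _) (fun z => ?_) ((hf.add hg).mul_left 2)
  have := norm_sub_le (f z) (g z)
  nlinarith [norm_nonneg (f z - g z), norm_nonneg (f z), norm_nonneg (g z), sq_nonneg (‖f z‖ - ‖g z‖)]

/-- **`G_j(f − g) = G_jf − G_jg`** for `f, g ∈ ℓ¹(ξℤ^{d+1})` (`m² > 0`, `a ≥ 0`): both sides are square-summable solutions of
(2.44) with right-hand side `f − g`, and the `ℓ²` solution is unique. [cite: Balaban1983RegularityDecay, (2.44)–(2.46) p.584] -/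
theorem G246_sub (n : ℕ) [NeZero n] {a m2 : ℝ} (ha : 0 ≤ a) (hm : 0 < m2) {f g : (Fin (d + 1) → ℤ) → ℂ}
    (hf : Summable fun z => ‖f z‖) (hg : Summable fun z => ‖g z‖) :
    G246 n a m2 (fun z => f z - g z) = fun z => G246 n a m2 f z - G246 n a m2 g z := by
  symm
  refine G246_eq_of_solution_l2 n (Nat.succ_pos d) ha hm (summable_norm_sub hf hg)
    (summable_normSq_sub (summable_normSq_G246 n ha hm hf) (summable_normSq_G246 n ha hm hg)) fun z => ?_
  have h := opD_sub n a m2 (G246 n a m2 f) (G246 n a m2 g) z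
  rw [opD_G246 n ha hm hf z, opD_G246 n ha hm hg z] at h
  rw [← h]
  rfl

/-! ### §3 Surjectivity on `ℓ²`: the free propagator exists on all of `ℓ²(ξℤ^{d+1})` -/

/-- a finitely supported field is summable. [folklore] -/
private theorem summable_norm_truncation (f : (Fin (d + 1) → ℤ) → ℂ) (s : Finset (Fin (d + 1) → ℤ)) :
    Summable fun z => ‖(if z ∈ s then f z else 0)‖ := by
  refine summable_of_ne_finset_zero (s := s) fun z hz => ?_
  rw [if_neg hz, norm_zero]

/-- **SURJECTIVITY OF `−Δ^ξ + m² + aQ_j^*Q_j` ON `ℓ²(ξℤ^{d+1})`** (`m² > 0`, `a ≥ 0`): every square-summable `f` is `Dψ` for a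
square-summable `ψ` — the `ℓ²` limit of `G_j(f·1_{[−N,N]^{d+1}})`, which is `ℓ²`-Cauchy by (2.28) because the truncations
converge to `f` in `ℓ²`. [cite: Balaban1983RegularityDecay, (1.6) p.572, (1.8) p.573, (2.28) p.580, (2.44) p.584; dictionary (Ω = ξℤ^{d+1}, A = 0)] -/
theorem exists_l2_solution (n : ℕ) [NeZero n] {a m2 : ℝ} (ha : 0 ≤ a) (hm : 0 < m2) {f : (Fin (d + 1) → ℤ) → ℂ}
    (hf : Summable fun z => ‖f z‖ ^ 2) :
    ∃ ψ : (Fin (d + 1) → ℤ) → ℂ, (Summable fun z => ‖ψ z‖ ^ 2) ∧ ∀ z, opD n a m2 ψ z = f z := by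
  -- truncations and their propagators
  set cube : ℕ → Finset (Fin (d + 1) → ℤ) := fun N => Fintype.piFinset fun _ : Fin (d + 1) => Finset.Icc (-(N : ℤ)) N
    with hcube
  set fN : ℕ → (Fin (d + 1) → ℤ) → ℂ := fun N z => if z ∈ cube N then f z else 0 with hfN
  have hfN1 : ∀ N, Summable fun z => ‖fN N z‖ := fun N => summable_norm_truncation f (cube N)
  have hfN2 : ∀ N, Summable fun z => ‖fN N z‖ ^ 2 := fun N =>
    Literature.Analysis.FunctionSpaces.Torus.summable_norm_sq_of_summable_norm (hfN1 N)
  set ψ : ℕ → (Fin (d + 1) → ℤ) → ℂ := fun N => G246 n a m2 (fN N) with hψ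
  have hψ2 : ∀ N, Summable fun z => ‖ψ N z‖ ^ 2 := fun N => summable_normSq_G246 n ha hm (hfN1 N)
  have hγ : 0 < min 8 a + m2 := add_pos_of_nonneg_of_pos (le_min (by norm_num) ha) hm
  -- the truncations as elements of `lp`, converging to `f`
  set Φ : ℕ → lp (fun _ : Fin (d + 1) → ℤ => ℂ) 2 := fun N => ⟨fN N, memℓp_two (hfN2 N)⟩ with hΦ
  set Φf : lp (fun _ : Fin (d + 1) → ℤ => ℂ) 2 := ⟨f, memℓp_two hf⟩ with hΦf
  have hΦconv : Tendsto Φ atTop (𝓝 Φf) := by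
    rw [tendsto_iff_norm_sub_tendsto_zero]
    have h1 : ∀ N, ‖Φ N - Φf‖ = Real.sqrt (∑' z, ‖f z - fN N z‖ ^ 2) := by
      intro N
      rw [lp_norm_sub_eq_sqrt]
      congr 1
      exact tsum_congr fun z => by rw [norm_sub_rev]
    simp_rw [h1]
    have h2 := (Real.continuous_sqrt.tendsto 0).comp (tendsto_truncation (d := d) f)
    rw [Real.sqrt_zero] at h2
    exact h2
  have hΦcau : CauchySeq Φ := hΦconv.cauchySeq
  -- the propagators are `ℓ²`-Cauchy: `‖G_j(f_N − f_M)‖ ≤ γ₀⁻¹‖f_N − f_M‖`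
  have hC : ∀ ε > 0, ∃ N₀, ∀ N ≥ N₀, ∀ M ≥ N₀, Real.sqrt (∑' z, ‖ψ N z - ψ M z‖ ^ 2) < ε := by
    intro ε hε
    obtain ⟨N₀, hN₀⟩ := Metric.cauchySeq_iff.mp hΦcau ((min 8 a + m2) * ε) (mul_pos hγ hε)
    refine ⟨N₀, fun N hN M hM => ?_⟩
    have hd := hN₀ N hN M hM
    rw [dist_eq_norm, lp_norm_sub_eq_sqrt] at hd
    have hsub : ∀ z, ψ N z - ψ M z = G246 n a m2 (fun z => fN N z - fN M z) z := by
      intro z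
      have := congrFun (G246_sub n ha hm (hfN1 N) (hfN1 M)) z
      rw [this]
    simp_rw [hsub]
    have hb := G246_l2_bound' n ha hm (summable_norm_sub (hfN1 N) (hfN1 M))
    calc Real.sqrt (∑' z, ‖G246 n a m2 (fun z => fN N z - fN M z) z‖ ^ 2)
        ≤ (min 8 a + m2)⁻¹ * Real.sqrt (∑' z, ‖fN N z - fN M z‖ ^ 2) := hb
      _ < (min 8 a + m2)⁻¹ * ((min 8 a + m2) * ε) := by
          refine mul_lt_mul_of_pos_left ?_ (inv_pos.mpr hγ)
          exact hd
      _ = ε := by field_simp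
  -- the limit
  obtain ⟨φ, hφ2, hpt, -⟩ := exists_limit_of_cauchy hψ2 hC
  refine ⟨φ, hφ2, fun z => ?_⟩
  -- `Dφ(z) = lim D(G_jf_N)(z) = lim f_N(z) = f(z)`
  have h1 : Tendsto (fun N => opD n a m2 (ψ N) z) atTop (𝓝 (opD n a m2 φ z)) := tendsto_opD hpt n a m2 z
  have h2 : Tendsto (fun N => opD n a m2 (ψ N) z) atTop (𝓝 (f z)) := by
    have h3 : ∀ N, opD n a m2 (ψ N) z = fN N z := fun N => opD_G246 n ha hm (hfN1 N) z
    simp_rw [h3]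
    have hev : ∀ᶠ N in atTop, fN N z = f z := by
      have := (tendsto_cube_atTop (d := d)).eventually (eventually_ge_atTop ({z} : Finset (Fin (d + 1) → ℤ)))
      filter_upwards [this] with N hN
      have hz : z ∈ cube N := hN (Finset.mem_singleton_self z)
      simp only [hfN, hz, if_true]
    exact tendsto_const_nhds.congr' (hev.mono fun N h => h.symm)
  exact tendsto_nhds_unique h1 h2

/-- **`−Δ^ξ + m² + aQ_j^*Q_j` IS A BIJECTION OF `ℓ²(ξℤ^{d+1})`** (`m² > 0`, `a ≥ 0`): for every `f ∈ ℓ²` there is EXACTLY ONE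
`ψ ∈ ℓ²` with `Dψ = f` — the free propagator `G_j = D⁻¹` of (1.6) exists as an everywhere-defined inverse on `ℓ²(ξℤ^{d+1})`
(`Ω = ξℤ^{d+1}`, `A = 0`; our gloss of (1.6) with p. 573's «This bound justifies the definition (1.6)»).
[cite: Balaban1983RegularityDecay, (1.6) p.572, (1.8) p.573, (2.44) p.584; dictionary (Ω = ξℤ^{d+1}, A = 0)] -/
theorem existsUnique_l2_solution_of_l2 (n : ℕ) [NeZero n] {a m2 : ℝ} (ha : 0 ≤ a) (hm : 0 < m2)
    {f : (Fin (d + 1) → ℤ) → ℂ} (hf : Summable fun z => ‖f z‖ ^ 2) :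
    ∃! ψ : (Fin (d + 1) → ℤ) → ℂ, (Summable fun z => ‖ψ z‖ ^ 2) ∧ ∀ z, opD n a m2 ψ z = f z := by
  obtain ⟨ψ, hψ2, hψ⟩ := exists_l2_solution n ha hm hf
  refine ⟨ψ, ⟨hψ2, hψ⟩, fun ψ' hψ' => ?_⟩
  exact B4Eq244L2Unique.opD_injective_l2 n (Nat.succ_pos d) ha hm.le hψ'.1 hψ2 fun z => by rw [hψ'.2 z, hψ z]

/-- **«G_j ≤ c₀I» ON `ℓ²`**: every square-summable solution of `Dψ = f` obeys `(min{8,a} + m²)‖ψ‖_{ℓ²} ≤ ‖f‖_{ℓ²}` (`a ≥ 0`,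
`m² ≥ 0`; `B4Ineq227LatticeL2.norm_opD_ge`). [cite: Balaban1983RegularityDecay, (1.8) p.573, (2.28) p.580; repaired constant; dictionary (Ω = ξℤ^{d+1}, A = 0)] -/
theorem l2_solution_bound (n : ℕ) [NeZero n] {a m2 : ℝ} (ha : 0 ≤ a) (hm : 0 ≤ m2) {f ψ : (Fin (d + 1) → ℤ) → ℂ}
    (hψ2 : Summable fun z => ‖ψ z‖ ^ 2) (hψ : ∀ z, opD n a m2 ψ z = f z) :
    (min 8 a + m2) * Real.sqrt (∑' z, ‖ψ z‖ ^ 2) ≤ Real.sqrt (∑' z, ‖f z‖ ^ 2) := by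
  have h := norm_opD_ge n ha hm hψ2
  simp_rw [hψ] at h
  exact h

/-- on `ℓ¹` data the `ℓ²` solution is the propagator of (2.46): `ψ = G246 f`. [cite: Balaban1983RegularityDecay, (2.44)–(2.46) p.584] -/
theorem l2_solution_eq_G246 (n : ℕ) [NeZero n] {a m2 : ℝ} (ha : 0 ≤ a) (hm : 0 < m2) {f ψ : (Fin (d + 1) → ℤ) → ℂ}
    (hf : Summable fun z => ‖f z‖) (hψ2 : Summable fun z => ‖ψ z‖ ^ 2) (hψ : ∀ z, opD n a m2 ψ z = f z) :
    ψ = G246 n a m2 f :=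
  G246_eq_of_solution_l2 n (Nat.succ_pos d) ha hm hf hψ2 hψ


/-! ### §4 The massless case `m² = 0 < a`: the limit `m² ↓ 0` -/

/-- `D_{m²} = D₀ + m²` pointwise. [cite: Balaban1983RegularityDecay, (2.44) p.584] -/
private theorem opD_mass (n : ℕ) (a m2 : ℝ) (φ : (Fin (d + 1) → ℤ) → ℂ) (z : Fin (d + 1) → ℤ) :
    opD n a m2 φ z = opD n a 0 φ z + (m2 : ℂ) * φ z := by
  simp only [opD, Complex.ofReal_zero, zero_mul, add_zero]
  ring

/-- a value of an `ℓ²` field is at most its `ℓ²` norm. [folklore] -/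
private theorem norm_apply_le_sqrt {φ : (Fin (d + 1) → ℤ) → ℂ} (hφ : Summable fun z => ‖φ z‖ ^ 2) (z : Fin (d + 1) → ℤ) :
    ‖φ z‖ ≤ Real.sqrt (∑' w, ‖φ w‖ ^ 2) := by
  rw [← Real.sqrt_sq (norm_nonneg (φ z))]
  exact Real.sqrt_le_sqrt (hφ.le_tsum z fun w _ => sq_nonneg _)

/-- `Σ|αφ − βψ|² ≤ 2α²Σ|φ|² + 2β²Σ|ψ|²`. [folklore] -/
private theorem tsum_normSq_smul_sub_le {φ ψ : (Fin (d + 1) → ℤ) → ℂ} (hφ : Summable fun z => ‖φ z‖ ^ 2)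
    (hψ : Summable fun z => ‖ψ z‖ ^ 2) (α β : ℝ) :
    ∑' z, ‖(α : ℂ) * φ z - (β : ℂ) * ψ z‖ ^ 2 ≤ 2 * α ^ 2 * ∑' z, ‖φ z‖ ^ 2 + 2 * β ^ 2 * ∑' z, ‖ψ z‖ ^ 2 := by
  have hpt : ∀ z, ‖(α : ℂ) * φ z - (β : ℂ) * ψ z‖ ^ 2 ≤ 2 * α ^ 2 * ‖φ z‖ ^ 2 + 2 * β ^ 2 * ‖ψ z‖ ^ 2 := by
    intro z
    have h1 := norm_sub_le ((α : ℂ) * φ z) ((β : ℂ) * ψ z)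
    rw [norm_mul, norm_mul, Complex.norm_real, Complex.norm_real, Real.norm_eq_abs, Real.norm_eq_abs] at h1
    have h2 : 0 ≤ ‖(α : ℂ) * φ z - (β : ℂ) * ψ z‖ := norm_nonneg _
    nlinarith [sq_nonneg (|α| * ‖φ z‖ - |β| * ‖ψ z‖), sq_abs α, sq_abs β, abs_nonneg α, abs_nonneg β,
      norm_nonneg (φ z), norm_nonneg (ψ z)]
  have hmaj : Summable fun z => 2 * α ^ 2 * ‖φ z‖ ^ 2 + 2 * β ^ 2 * ‖ψ z‖ ^ 2 :=
    (hφ.mul_left _).add (hψ.mul_left _)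
  have hs : Summable fun z => ‖(α : ℂ) * φ z - (β : ℂ) * ψ z‖ ^ 2 :=
    Summable.of_nonneg_of_le (fun z => sq_nonneg _) hpt hmaj
  calc ∑' z, ‖(α : ℂ) * φ z - (β : ℂ) * ψ z‖ ^ 2 ≤ ∑' z, (2 * α ^ 2 * ‖φ z‖ ^ 2 + 2 * β ^ 2 * ‖ψ z‖ ^ 2) :=
        hs.tsum_le_tsum hpt hmaj
    _ = 2 * α ^ 2 * ∑' z, ‖φ z‖ ^ 2 + 2 * β ^ 2 * ∑' z, ‖ψ z‖ ^ 2 := by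
        rw [(hφ.mul_left _).tsum_add (hψ.mul_left _), tsum_mul_left, tsum_mul_left]

/-- **THE MASSLESS FREE PROPAGATOR ON `ℓ²(ξℤ^{d+1})`** (`m² = 0`, `a > 0`, where (1.8) still gives `γ₀ = min{8,a} > 0`): every
square-summable `f` is `(−Δ^ξ + aQ_j^*Q_j)ψ` for a square-summable `ψ` — the `ℓ²` limit, as `m² ↓ 0`, of the massive solutions
`ψ_{m²} = (−Δ^ξ + m² + aQ_j^*Q_j)⁻¹f` of §3, which are `ℓ²`-Cauchy by (1.8) at `m² = 0`:
`γ₀‖ψ_{m²} − ψ_{m′²}‖ ≤ ‖m′²ψ_{m′²} − m²ψ_{m²}‖ ≤ (m² + m′²)‖f‖/γ₀`.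
[cite: Balaban1983RegularityDecay, (1.6) p.572 «m² ≥ 0 and a … positive», (1.8) p.573; dictionary (Ω = ξℤ^{d+1}, A = 0)] -/
theorem exists_l2_solution_massless (n : ℕ) [NeZero n] {a : ℝ} (ha : 0 < a) {f : (Fin (d + 1) → ℤ) → ℂ}
    (hf : Summable fun z => ‖f z‖ ^ 2) :
    ∃ ψ : (Fin (d + 1) → ℤ) → ℂ, (Summable fun z => ‖ψ z‖ ^ 2) ∧ ∀ z, opD n a 0 ψ z = f z := by
  have hγ : 0 < min 8 a := lt_min (by norm_num) ha
  -- the masses `m_k² = 1/(k+1)` and the massive solutions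
  set mk : ℕ → ℝ := fun k => 1 / ((k : ℝ) + 1) with hmk
  have hmk_pos : ∀ k, 0 < mk k := fun k => by rw [hmk]; positivity
  have hex : ∀ k, ∃ ψ : (Fin (d + 1) → ℤ) → ℂ, (Summable fun z => ‖ψ z‖ ^ 2) ∧ ∀ z, opD n a (mk k) ψ z = f z :=
    fun k => exists_l2_solution n ha.le (hmk_pos k) hf
  choose ψ hψ2 hψ using hex
  -- uniform bound `‖ψ_k‖ ≤ ‖f‖/γ₀`
  set B : ℝ := (min 8 a)⁻¹ * Real.sqrt (∑' z, ‖f z‖ ^ 2) with hB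
  have hB0 : 0 ≤ B := by positivity
  have hbound : ∀ k, Real.sqrt (∑' z, ‖ψ k z‖ ^ 2) ≤ B := by
    intro k
    have h1 := l2_solution_bound n ha.le (hmk_pos k).le (hψ2 k) (hψ k)
    rw [hB, le_inv_mul_iff₀ hγ]
    calc min 8 a * Real.sqrt (∑' z, ‖ψ k z‖ ^ 2) ≤ (min 8 a + mk k) * Real.sqrt (∑' z, ‖ψ k z‖ ^ 2) :=
          mul_le_mul_of_nonneg_right (le_add_of_nonneg_right (hmk_pos k).le) (Real.sqrt_nonneg _)
      _ ≤ _ := h1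
  -- `m_k → 0`
  have hmk_tendsto : Tendsto mk atTop (𝓝 0) := by
    rw [hmk]
    exact tendsto_one_div_add_atTop_nhds_zero_nat
  -- Cauchy in `ℓ²`: `γ₀‖ψ_k − ψ_l‖ ≤ ‖m_lψ_l − m_kψ_k‖ ≤ 2B(m_k + m_l)`-ish
  have hC : ∀ ε > 0, ∃ N₀, ∀ N ≥ N₀, ∀ M ≥ N₀, Real.sqrt (∑' z, ‖ψ N z - ψ M z‖ ^ 2) < ε := by
    intro ε hε
    -- choose `N₀` with `m_k ≤ δ` for `k ≥ N₀`, where `2·B·δ·… < γ₀ε`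
    set δ : ℝ := min 8 a * ε / (4 * B + 4) with hδ
    have hδ0 : 0 < δ := by rw [hδ]; positivity
    obtain ⟨N₀, hN₀⟩ := (Metric.tendsto_atTop.mp hmk_tendsto) δ hδ0
    refine ⟨N₀, fun N hN M hM => ?_⟩
    have hmN : mk N < δ := by have := hN₀ N hN; rwa [Real.dist_eq, sub_zero, abs_of_pos (hmk_pos N)] at this
    have hmM : mk M < δ := by have := hN₀ M hM; rwa [Real.dist_eq, sub_zero, abs_of_pos (hmk_pos M)] at this
    -- the difference and its image under `D₀`
    have hdiff2 : Summable fun z => ‖ψ N z - ψ M z‖ ^ 2 := summable_normSq_sub (hψ2 N) (hψ2 M)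
    have hD0 : ∀ z, opD n a 0 (fun z => ψ N z - ψ M z) z = (mk M : ℂ) * ψ M z - (mk N : ℂ) * ψ N z := by
      intro z
      have e1 := hψ N z
      have e2 := hψ M z
      rw [opD_mass] at e1 e2
      have e3 := opD_sub n a 0 (ψ N) (ψ M) z
      have e4 : opD n a 0 (fun z => ψ N z - ψ M z) z = opD n a 0 (ψ N - ψ M) z := rfl
      rw [e4, e3]
      linear_combination e1 - e2
    have hlow := norm_opD_ge n ha.le le_rfl hdiff2
    simp_rw [hD0, add_zero] at hlow
    -- `‖m_Mψ_M − m_Nψ_N‖² ≤ 2m_M²B² + 2m_N²B²`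
    have hup : ∑' z, ‖(mk M : ℂ) * ψ M z - (mk N : ℂ) * ψ N z‖ ^ 2 ≤ 2 * δ ^ 2 * B ^ 2 + 2 * δ ^ 2 * B ^ 2 := by
      have h1 := tsum_normSq_smul_sub_le (hψ2 M) (hψ2 N) (mk M) (mk N)
      have hBM : ∑' z, ‖ψ M z‖ ^ 2 ≤ B ^ 2 := by
        have := hbound M
        rw [← Real.sqrt_le_sqrt_iff (by positivity), Real.sqrt_sq hB0]; exact this
      have hBN : ∑' z, ‖ψ N z‖ ^ 2 ≤ B ^ 2 := by
        have := hbound N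
        rw [← Real.sqrt_le_sqrt_iff (by positivity), Real.sqrt_sq hB0]; exact this
      have hmM2 : mk M ^ 2 ≤ δ ^ 2 := pow_le_pow_left₀ (hmk_pos M).le hmM.le 2
      have hmN2 : mk N ^ 2 ≤ δ ^ 2 := pow_le_pow_left₀ (hmk_pos N).le hmN.le 2
      have t0 : 0 ≤ ∑' z, ‖ψ M z‖ ^ 2 := tsum_nonneg fun z => sq_nonneg _
      have t1 : 0 ≤ ∑' z, ‖ψ N z‖ ^ 2 := tsum_nonneg fun z => sq_nonneg _
      nlinarith [mul_le_mul hmM2 hBM t0 (sq_nonneg δ), mul_le_mul hmN2 hBN t1 (sq_nonneg δ)]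
    have hup' : Real.sqrt (∑' z, ‖(mk M : ℂ) * ψ M z - (mk N : ℂ) * ψ N z‖ ^ 2) ≤ 2 * δ * B := by
      rw [← Real.sqrt_sq (by positivity : (0 : ℝ) ≤ 2 * δ * B)]
      exact Real.sqrt_le_sqrt (by nlinarith [hup])
    -- conclude
    have hfin : min 8 a * Real.sqrt (∑' z, ‖ψ N z - ψ M z‖ ^ 2) ≤ 2 * δ * B := hlow.trans hup'
    have hlt : 2 * δ * B < min 8 a * ε := by
      rw [hδ]
      have h4 : 0 < 4 * B + 4 := by positivity
      calc 2 * (min 8 a * ε / (4 * B + 4)) * B = min 8 a * ε * (2 * B / (4 * B + 4)) := by ring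
        _ < min 8 a * ε * 1 := by
            refine mul_lt_mul_of_pos_left ?_ (mul_pos hγ hε)
            rw [div_lt_one h4]; linarith
        _ = min 8 a * ε := mul_one _
    by_contra hge
    push Not at hge
    have := mul_le_mul_of_nonneg_left hge hγ.le
    linarith
  -- the limit and its equation
  obtain ⟨φ, hφ2, hpt, -⟩ := exists_limit_of_cauchy hψ2 hC
  refine ⟨φ, hφ2, fun z => ?_⟩
  have h1 : Tendsto (fun k => opD n a 0 (ψ k) z) atTop (𝓝 (opD n a 0 φ z)) := tendsto_opD hpt n a 0 z
  have h2 : Tendsto (fun k => opD n a 0 (ψ k) z) atTop (𝓝 (f z)) := by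
    have h3 : ∀ k, opD n a 0 (ψ k) z = f z - (mk k : ℂ) * ψ k z := by
      intro k
      have := hψ k z
      rw [opD_mass] at this
      linear_combination this
    simp_rw [h3]
    have h4 : Tendsto (fun k => (mk k : ℂ) * ψ k z) atTop (𝓝 0) := by
      refine squeeze_zero_norm (fun k => ?_) ?_ (a := fun k => mk k * B)
      · rw [norm_mul, Complex.norm_real, Real.norm_eq_abs, abs_of_pos (hmk_pos k)]
        exact mul_le_mul_of_nonneg_left ((norm_apply_le_sqrt (hψ2 k) z).trans (hbound k)) (hmk_pos k).le
      · have := hmk_tendsto.mul_const B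
        rwa [zero_mul] at this
    have h5 := (tendsto_const_nhds (x := f z)).sub h4
    rwa [sub_zero] at h5
  exact tendsto_nhds_unique h1 h2

/-- **(1.6) FOR `Ω = ξℤ^{d+1}`, `A = 0`, IN PRINT'S FULL PARAMETER RANGE** «m² ≥ 0 and a is a positive constant» (and also
`a = 0 < m²`): whenever `γ₀ = min{8,a} + m² > 0`, the operator `−Δ^ξ + m² + aQ_j^*Q_j` is a BIJECTION of `ℓ²(ξℤ^{d+1})` — for
every square-summable `f` there is exactly one square-summable `ψ` with `Dψ = f`, and `γ₀‖ψ‖_{ℓ²} ≤ ‖f‖_{ℓ²}`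
(`l2_solution_bound`). [cite: Balaban1983RegularityDecay, (1.6) p.572, (1.8) p.573, (2.28) p.580; dictionary (Ω = ξℤ^{d+1}, A = 0)] -/
theorem existsUnique_l2_solution_of_pos (n : ℕ) [NeZero n] {a m2 : ℝ} (ha : 0 ≤ a) (hm : 0 ≤ m2)
    (hγ : 0 < min 8 a + m2) {f : (Fin (d + 1) → ℤ) → ℂ} (hf : Summable fun z => ‖f z‖ ^ 2) :
    ∃! ψ : (Fin (d + 1) → ℤ) → ℂ, (Summable fun z => ‖ψ z‖ ^ 2) ∧ ∀ z, opD n a m2 ψ z = f z := by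
  have hex : ∃ ψ : (Fin (d + 1) → ℤ) → ℂ, (Summable fun z => ‖ψ z‖ ^ 2) ∧ ∀ z, opD n a m2 ψ z = f z := by
    rcases hm.lt_or_eq with hm' | hm'
    · exact exists_l2_solution n ha hm' hf
    · subst hm'
      have ha' : 0 < a := by
        by_contra h
        push Not at h
        have : a = 0 := le_antisymm h ha
        rw [this, add_zero] at hγ
        have : min (8 : ℝ) 0 ≤ 0 := min_le_right _ _
        linarith
      exact exists_l2_solution_massless n ha' hf
  obtain ⟨ψ, hψ2, hψ⟩ := hex
  refine ⟨ψ, ⟨hψ2, hψ⟩, fun ψ' hψ' => ?_⟩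
  exact opD_injective_l2_of_pos n ha hm hγ hψ'.1 hψ2 fun z => by rw [hψ'.2 z, hψ z]

end

end Literature.MathematicalPhysics.QuantumFieldTheory.Balaban1983to89.B4Eq16FreePropagatorL2
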